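import Summits.KontsevichZagierPeriods.KontsevichZagierPeriods.Theses.TorsionLogs
import Summits.KontsevichZagierPeriods.KontsevichZagierPeriods.Theorems.TorsionLogsNeronTorsionSectorAssemblyMain
import Summits.KontsevichZagierPeriods.KontsevichZagierPeriods.Theorems.TorsionLogsTorsionSectorCompleteReductions
import Literature.NumberTheory.Transcendental.KZKernelConjectureForms

/-!
# Crux `TorsionSectorComplete` (stmt-KontsevichZagierPeriods-14212) — line `NeronAddition`
# (forward generator G1 `next-rung` over the floor `NeronTorsionPrimitiveChain`, unit fwd2-rung-KontsevichZagierPeriods-01-g6)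

FLOOR (seed g1-KontsevichZagierPeriods-17981, PROVED):
`Summit.KontsevichZagierPeriods.KontsevichZagierPeriods.Cruxes.NeronTorsionSector.Translation.stub_assembly` — the
primitive Néron–torsion chain `q²[rI_P] + p²[rP] − c[rB] ∈ KZ.relations` at ONE real `N`-torsion point `P` of the
identity component, built on the FINITE torsion-translation grid `x_k = X(kω₁/n)` (isogeny datum `N·P = O`).

RUNG `NeronAddition := ∀ addition : Bool, NeronAdditionMember addition` (this file).
ONE hypothesis of the floor is generalised: the datum "`P` is `N`-torsion" (`addOrderOf P = N`, which closes the
translation grid) becomes the ADDITION datum of THREE arbitrary real algebraic points `P₁, P₂, Q` of the identity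
component (`e₁ < x₂ < x₁ < x_Q`; no torsion, no order, no sign-of-`e₁` hypothesis), i.e. the chord abscissae
`x(P_i ± Q)`; the element becomes the second-difference ("quasi-parallelogram") element
`[rI(x(P₂+Q))] + [rI(x(P₂−Q))] − 2[rI(x₂)] − [rI(x(P₁+Q))] − [rI(x(P₁−Q))] + 2[rI(x₁)] + [x_Q−x₁ < t < x_Q−x₂, dt/t]`
(value: the `P`-second difference of the quasi-parallelogram law of the archimedean Néron function
`λ(P+Q) + λ(P−Q) = 2λ(P) + 2λ(Q) − log|x(P) − x(Q)| + (1/6) log|Δ|` [Silverman, ATAEC VI Cor. 3.3] — every `λ(Q)`,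
`Δ` and quasi-period term cancels in the difference; `Σ_i (−1)^i [I(P_i+Q) + I(P_i−Q) − 2I(P_i)] + log((x_Q−x₂)/(x_Q−x₁)) = 0`
verified numerically to `3·10⁻¹⁵` on eight configurations incl. `Δ < 0`, `e₁ < 0`, `x₂ → e₁`; `compute/shear_check.py`
of the filing seat).
* member `false` = the floor VERBATIM (torsion member) — `neronAdditionMember_false := stub_assembly`; F3 witness file
  `Lines/NeronAddition_special.lean`;
* member `true` = the addition member (NEW; non-torsion points allowed, outside every torsion/isogeny sector) — from
  the two registered stubs (`neronAdditionMember_true_of`);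
* on-path (F4): `KontsevichZagierPeriods → NeronAddition` PROVED (`neronAddition_of_kontsevichZagierPeriods`, also
  `Lines/NeronAddition_onpath.lean`): kernel form of Conjecture 1 + the value hypothesis (tied form);
* the crux BY NAME: `TorsionSectorComplete_of` from the three stubs (rung ⇒ `closure AdditionTied ≤ relations`, so
  the residual's enlarged sector collapses to the torsion sector).

WHY THE FLOOR'S PROOF STOPS (located failure): `TorsionLogsNeronTorsionSectorStubGridData.lean` closes the finite grid
`x_k = X(kω₁/n)` by periodicity/reflection (`hper`, `hsym`) — this needs `N·P = O`; for three free points there is no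
finite algebraic grid and the translation-cocycle telescoping (`StubTranslationCalculus`) has nothing to sum over (the
same wall the `[n]`-lines hit; they answer with the `n²`-sheeted correspondence `[n]` and a second-kind cocycle).
REPLACEMENT (technique menu: change of variables by a ONE-sheeted algebraic correspondence on the SQUARE `E⁰ × E⁰`,
plus Fubini): the ADDITION SHEAR `(x, y) ↦ (x(P_x + Q_y), y)` — a CONTINUOUS family of translations parametrised by the
second factor — applied to the addition-kernel representation `∬ dx dy/(y − x)²` over `{x₂ < x < x₁} × {x_Q < y}`:
(i) the algebraic kernel identity `x(P+Q) − x(P−Q) = −y_P·y_Q/(x_P − x_Q)²` (analytic form in the tree: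
`PeriodPair.weierstrassP_sub_eq_sigma_holds`, `derivWeierstrassP_div_sub_eq`) rewrites the kernel as
`(x(P_x−Q_y) − x(P_x+Q_y))·(dx/√f(x))·(dy/√f(y))` up to sign (rule 1b); (ii) the shear is injective fibrewise with
`dx/√f(x) = ds/√f(s)` (`ω = dx/y` is translation-INVARIANT: no cocycle, no quasi-period term — rule 2);
(iii) re-describing the sheared region by its `s`-fibres and cutting along the algebraic curves `y = x(R_s ∓ P_i)`
(rule 1a), the inner `dy/√f(y)`-integrals are carried to `dx'/√f(x')`-integrals by the FIXED translations `τ_{P_i}`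
(rule 2), leaving general Néron triangles/rectangles `[{x_b < x' < x < x_a}, x' dx' dx/(√f√f)]`, which the landed
`TriangleConcatenation` (item 13809, `triangleConcatenation_proof`) reassembles into the six `e₁`-based triangles
(stub 1); (iv) the kernel strip itself unfolds to the logarithmic carrier by one compactifying change of variables and
one fibrewise Newton–Leibniz move with the RATIONAL primitive `−1/(s+t)` (stub 2) — no transcendental primitive, one
extra variable: the printed evasion of `Literature.Barriers.KontsevichZagierPeriods.AlgebraicPrimitivesObstruction`.
-/

namespace Summit.KontsevichZagierPeriods.KontsevichZagierPeriods.Cruxes.TorsionSectorComplete.NeronAddition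

open Literature.NumberTheory.Transcendental
open Summit.KontsevichZagierPeriods.KontsevichZagierPeriods.Theses.TorsionLogs (TorsionSectorComplete)
open Summit.KontsevichZagierPeriods.KontsevichZagierPeriods.Cruxes.NeronTorsionSector.Translation (stub_assembly)

/-- MEMBER `addition` of the rung.
* `addition = false` — the TORSION member: the floor `TorsionLogs.NeronTorsionPrimitiveChain` verbatim (one real
  `N`-torsion point `P` of the identity component; primitive chain `q²[rI_P] + p²[rP] − c[rB] ∈ relations`).
* `addition = true` — the ADDITION member (NEW): `y² = f(x) = 4x³ − g₂x − g₃`, `Δ ≠ 0`, `e₁` the largest real root,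
  three points `P₁ = (x₁,y₁)`, `P₂ = (x₂,y₂)`, `Q = (x_Q,y_Q)` of the identity component with `e₁ < x₂ < x₁ < x_Q`
  (no torsion, no order, no sign hypothesis), the chord abscissae `x(P_i + Q) = ((y_i − y_Q)/(x_i − x_Q))²/4 − x_i − x_Q`,
  `x(P_i − Q) = ((y_i + y_Q)/(x_i − x_Q))²/4 − x_i − x_Q`, the six Néron triangles
  `rI(x_R) = [{e₁ < x' < x < x_R}, x' dx' dx/(√f(x')√f(x))]` at `x_R ∈ {x(P_i ± Q), x_i}`, the logarithmic carrier
  `rL = [{x_Q − x₁ < t < x_Q − x₂}, dt/t]`, and the value hypothesis (tied form). CLAIM: the second-difference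
  ("quasi-parallelogram") element
  `[rI(x(P₂+Q))] + [rI(x(P₂−Q))] − 2[rI(x₂)] − [rI(x(P₁+Q))] − [rI(x(P₁−Q))] + 2[rI(x₁)] + [rL]`
  is a relation of the KZ move calculus. (Value identity
  `Σ_i (−1)^i [I(P_i+Q) + I(P_i−Q) − 2 I(P_i)] + log((x_Q−x₂)/(x_Q−x₁)) = 0`, verified numerically to `3·10⁻¹⁵`
  on eight configurations incl. `Δ < 0`, `e₁ < 0`, `x₂ → e₁`.) [cite: KontsevichZagier2001, §1.2] [cite: SilvermanATAEC1994, VI Cor. 3.3] -/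
def NeronAdditionMember : Bool → Prop
  | false =>
    ∀ (g₂ g₃ e₁ xP yP : ℝ) (N a p q : ℕ) (f : ℝ → ℝ), (∀ x, f x = 4 * x ^ 3 - g₂ * x - g₃) →
      g₂ ^ 3 - 27 * g₃ ^ 2 ≠ 0 → f e₁ = 0 → 0 < e₁ → (∀ x, e₁ < x → 0 < f x) → e₁ < xP → yP ^ 2 = f xP →
      3 ≤ N → 0 < a → 2 * a < N →
      (∀ hns : (⟨0, 0, 0, -g₂ / 4, -g₃ / 4⟩ : WeierstrassCurve ℝ).toAffine.Nonsingular xP (yP / 2),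
        addOrderOf (WeierstrassCurve.Affine.Point.some xP (yP / 2) hns) = N) →
      (N : ℝ) * (∫ x in Set.Ioi xP, (Real.sqrt (f x))⁻¹) = a * (2 * ∫ x in Set.Ioi e₁, (Real.sqrt (f x))⁻¹) →
      Nat.Coprime p q → (q : ℤ) * ((N : ℤ) - 2 * (a : ℤ)) = (p : ℤ) * (2 * (N : ℤ)) →
      ∀ (rI rP : KZ.IntegralRep 2),
      rI.domain = {z | e₁ < z 1 ∧ z 1 < z 0 ∧ z 0 < xP} →
      Set.EqOn rI.integrand (fun z => z 1 / (Real.sqrt (f (z 1)) * Real.sqrt (f (z 0)))) rI.domain →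
      rP.domain = {z | e₁ < z 0 ∧ e₁ < z 1} →
      Set.EqOn rP.integrand
        (fun z => (Real.sqrt (f (z 0)))⁻¹ * ((g₂ * z 1 + 2 * g₃) / (2 * (z 1) ^ 2 * Real.sqrt (f (z 1))))) rP.domain →
      ∃ (c : ℤ) (B : ℝ) (rB : KZ.IntegralRep 1), 1 < B ∧ IsAlgebraic ℚ B ∧
        rB.domain = {t | 1 < t 0 ∧ t 0 < B} ∧ Set.EqOn rB.integrand (fun t => (t 0)⁻¹) rB.domain ∧
        ((q : ℤ) ^ 2) • KZ.of rI + ((p : ℤ) ^ 2) • KZ.of rP - c • KZ.of rB ∈ KZ.relations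
  | true =>
    ∀ (g₂ g₃ e₁ x₁ y₁ x₂ y₂ xQ yQ xS₁ xD₁ xS₂ xD₂ : ℝ) (f : ℝ → ℝ),
      (∀ x, f x = 4 * x ^ 3 - g₂ * x - g₃) → g₂ ^ 3 - 27 * g₃ ^ 2 ≠ 0 → f e₁ = 0 →
      (∀ x, e₁ < x → 0 < f x) → e₁ < x₂ → x₂ < x₁ → x₁ < xQ →
      y₁ ^ 2 = f x₁ → y₂ ^ 2 = f x₂ → yQ ^ 2 = f xQ →
      xS₁ = ((y₁ - yQ) / (x₁ - xQ)) ^ 2 / 4 - x₁ - xQ → xD₁ = ((y₁ + yQ) / (x₁ - xQ)) ^ 2 / 4 - x₁ - xQ →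
      xS₂ = ((y₂ - yQ) / (x₂ - xQ)) ^ 2 / 4 - x₂ - xQ → xD₂ = ((y₂ + yQ) / (x₂ - xQ)) ^ 2 / 4 - x₂ - xQ →
      ∀ (rS₁ rD₁ rP₁ rS₂ rD₂ rP₂ : KZ.IntegralRep 2) (rL : KZ.IntegralRep 1),
      rS₁.domain = {z | e₁ < z 1 ∧ z 1 < z 0 ∧ z 0 < xS₁} →
      Set.EqOn rS₁.integrand (fun z => z 1 / (Real.sqrt (f (z 1)) * Real.sqrt (f (z 0)))) rS₁.domain →
      rD₁.domain = {z | e₁ < z 1 ∧ z 1 < z 0 ∧ z 0 < xD₁} →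
      Set.EqOn rD₁.integrand (fun z => z 1 / (Real.sqrt (f (z 1)) * Real.sqrt (f (z 0)))) rD₁.domain →
      rP₁.domain = {z | e₁ < z 1 ∧ z 1 < z 0 ∧ z 0 < x₁} →
      Set.EqOn rP₁.integrand (fun z => z 1 / (Real.sqrt (f (z 1)) * Real.sqrt (f (z 0)))) rP₁.domain →
      rS₂.domain = {z | e₁ < z 1 ∧ z 1 < z 0 ∧ z 0 < xS₂} →
      Set.EqOn rS₂.integrand (fun z => z 1 / (Real.sqrt (f (z 1)) * Real.sqrt (f (z 0)))) rS₂.domain →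
      rD₂.domain = {z | e₁ < z 1 ∧ z 1 < z 0 ∧ z 0 < xD₂} →
      Set.EqOn rD₂.integrand (fun z => z 1 / (Real.sqrt (f (z 1)) * Real.sqrt (f (z 0)))) rD₂.domain →
      rP₂.domain = {z | e₁ < z 1 ∧ z 1 < z 0 ∧ z 0 < x₂} →
      Set.EqOn rP₂.integrand (fun z => z 1 / (Real.sqrt (f (z 1)) * Real.sqrt (f (z 0)))) rP₂.domain →
      rL.domain = {t | xQ - x₁ < t 0 ∧ t 0 < xQ - x₂} → Set.EqOn rL.integrand (fun t => (t 0)⁻¹) rL.domain →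
      rS₂.value + rD₂.value - 2 * rP₂.value - rS₁.value - rD₁.value + 2 * rP₁.value + rL.value = 0 →
      KZ.of rS₂ + KZ.of rD₂ - (2 : ℤ) • KZ.of rP₂ - KZ.of rS₁ - KZ.of rD₁ + (2 : ℤ) • KZ.of rP₁ + KZ.of rL
        ∈ KZ.relations

/-- THE RUNG: both members. [cite: KontsevichZagier2001, §1.2] -/
def NeronAddition : Prop := ∀ addition : Bool, NeronAdditionMember addition

/-- STUB 1 statement — the ADDITION SHEAR (the new move; primitive, no value hypothesis). Same data as the
addition member, with the logarithmic carrier replaced by the ADDITION-KERNEL strip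
`rK = [{x_Q − x₁ < s < x_Q − x₂} × {0 < t}, ds dt/(s + t)²]` (= `∬ dx dy/(y − x)²` over `x₂ < x < x₁`, `x_Q < y`
in the coordinates `s = x_Q − x`, `t = y − x_Q`). CLAIM:
`[rI(x(P₂+Q))] + [rI(x(P₂−Q))] − 2[rI(x₂)] − [rI(x(P₁+Q))] − [rI(x(P₁−Q))] + 2[rI(x₁)] + [rK] ∈ relations`. [cite: KontsevichZagier2001, §1.2] -/
def AdditionShear : Prop :=
  ∀ (g₂ g₃ e₁ x₁ y₁ x₂ y₂ xQ yQ xS₁ xD₁ xS₂ xD₂ : ℝ) (f : ℝ → ℝ),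
    (∀ x, f x = 4 * x ^ 3 - g₂ * x - g₃) → g₂ ^ 3 - 27 * g₃ ^ 2 ≠ 0 → f e₁ = 0 →
    (∀ x, e₁ < x → 0 < f x) → e₁ < x₂ → x₂ < x₁ → x₁ < xQ →
    y₁ ^ 2 = f x₁ → y₂ ^ 2 = f x₂ → yQ ^ 2 = f xQ →
    xS₁ = ((y₁ - yQ) / (x₁ - xQ)) ^ 2 / 4 - x₁ - xQ → xD₁ = ((y₁ + yQ) / (x₁ - xQ)) ^ 2 / 4 - x₁ - xQ →
    xS₂ = ((y₂ - yQ) / (x₂ - xQ)) ^ 2 / 4 - x₂ - xQ → xD₂ = ((y₂ + yQ) / (x₂ - xQ)) ^ 2 / 4 - x₂ - xQ →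
    ∀ (rS₁ rD₁ rP₁ rS₂ rD₂ rP₂ rK : KZ.IntegralRep 2),
    rS₁.domain = {z | e₁ < z 1 ∧ z 1 < z 0 ∧ z 0 < xS₁} →
    Set.EqOn rS₁.integrand (fun z => z 1 / (Real.sqrt (f (z 1)) * Real.sqrt (f (z 0)))) rS₁.domain →
    rD₁.domain = {z | e₁ < z 1 ∧ z 1 < z 0 ∧ z 0 < xD₁} →
    Set.EqOn rD₁.integrand (fun z => z 1 / (Real.sqrt (f (z 1)) * Real.sqrt (f (z 0)))) rD₁.domain →
    rP₁.domain = {z | e₁ < z 1 ∧ z 1 < z 0 ∧ z 0 < x₁} →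
    Set.EqOn rP₁.integrand (fun z => z 1 / (Real.sqrt (f (z 1)) * Real.sqrt (f (z 0)))) rP₁.domain →
    rS₂.domain = {z | e₁ < z 1 ∧ z 1 < z 0 ∧ z 0 < xS₂} →
    Set.EqOn rS₂.integrand (fun z => z 1 / (Real.sqrt (f (z 1)) * Real.sqrt (f (z 0)))) rS₂.domain →
    rD₂.domain = {z | e₁ < z 1 ∧ z 1 < z 0 ∧ z 0 < xD₂} →
    Set.EqOn rD₂.integrand (fun z => z 1 / (Real.sqrt (f (z 1)) * Real.sqrt (f (z 0)))) rD₂.domain →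
    rP₂.domain = {z | e₁ < z 1 ∧ z 1 < z 0 ∧ z 0 < x₂} →
    Set.EqOn rP₂.integrand (fun z => z 1 / (Real.sqrt (f (z 1)) * Real.sqrt (f (z 0)))) rP₂.domain →
    rK.domain = {z | xQ - x₁ < z 0 ∧ z 0 < xQ - x₂ ∧ 0 < z 1} →
    Set.EqOn rK.integrand (fun z => ((z 0 + z 1) ^ 2)⁻¹) rK.domain →
    KZ.of rS₂ + KZ.of rD₂ - (2 : ℤ) • KZ.of rP₂ - KZ.of rS₁ - KZ.of rD₁ + (2 : ℤ) • KZ.of rP₁ + KZ.of rK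
      ∈ KZ.relations

/-- STUB 2 statement — the STRIP LOGARITHM (elementary): for `0 < a < b` and the logarithmic carrier
`rL = [{a < t < b}, dt/t]` there is an addition-kernel strip representation `rK = [{a < s < b} × {0 < t}, ds dt/(s+t)²]`
with `[rK] − [rL] ∈ relations` (rule 2 compactification `t ↦ t/(s+t)`, rule 3 fibrewise, rule 2 affine). [cite: KontsevichZagier2001, §1.2] -/
def StripLog : Prop :=
  ∀ (a b : ℝ), 0 < a → a < b → ∀ (rL : KZ.IntegralRep 1),
    rL.domain = {t | a < t 0 ∧ t 0 < b} → Set.EqOn rL.integrand (fun t => (t 0)⁻¹) rL.domain →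
    ∃ rK : KZ.IntegralRep 2, rK.domain = {z | a < z 0 ∧ z 0 < b ∧ 0 < z 1} ∧
      Set.EqOn rK.integrand (fun z => ((z 0 + z 1) ^ 2)⁻¹) rK.domain ∧ KZ.of rK - KZ.of rL ∈ KZ.relations

/-- The crux's own sector: the tied Néron–torsion elements (the set inside `TorsionSectorComplete`, verbatim). [cite: KontsevichZagier2001, §1.2] -/
def TorsionTied : Set KZ.FormalRep :=
  {d : KZ.FormalRep | ∃ (g₂ g₃ e₁ xP yP α : ℝ) (N a : ℕ) (M k m : ℤ) (f : ℝ → ℝ) (rI rP : KZ.IntegralRep 2) (rL : KZ.IntegralRep 1), (∀ x, f x = 4 * x ^ 3 - g₂ * x - g₃) ∧ g₂ ^ 3 - 27 * g₃ ^ 2 ≠ 0 ∧ f e₁ = 0 ∧ 0 < e₁ ∧ (∀ x, e₁ < x → 0 < f x) ∧ e₁ < xP ∧ yP ^ 2 = f xP ∧ 3 ≤ N ∧ 0 < a ∧ 2 * a < N ∧ 4 * (N : ℤ) ^ 2 * k = M * ((N : ℤ) - 2 * (a : ℤ)) ^ 2 ∧ (∀ hns : (⟨0, 0, 0, -g₂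 / 4, -g₃ / 4⟩ : WeierstrassCurve ℝ).toAffine.Nonsingular xP (yP / 2), addOrderOf (WeierstrassCurve.Affine.Point.some xP (yP / 2) hns) = N) ∧ (N : ℝ) * (∫ x in Set.Ioi xP, (Real.sqrt (f x))⁻¹) = a * (2 * ∫ x in Set.Ioi e₁, (Real.sqrt (f x))⁻¹) ∧ 1 < α ∧ rI.domain = {z | e₁ < z 1 ∧ z 1 < z 0 ∧ z 0 < xP} ∧ Set.EqOn rI.integrand (fun z => z 1 / (Real.sqrt (f (z 1)) * Real.sqrt (f (z 0)))) rI.domain ∧ rP.domain = {z | e₁ < z 0 ∧ e₁ < z 1} ∧ Set.EqOn rP.integrand (fun z => (Real.sqrt (f (z 0)))⁻¹ * ((g₂ * z 1 + 2 * g₃) / (2 * (z 1) ^ 2 * Real.sqrt (f (z 1))))) rP.domain ∧ rL.domain = {t | 1 < t 0 ∧ t 0 < α} ∧ Set.EqOn rL.integrand (fun t => (t 0)⁻¹) rL.domain ∧ (M : ℝ) * rI.value + k * rP.value = m * rL.value ∧ d = M • KZ.of rI + k • KZ.of rP - m • KZ.of rL}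

/-- Sanity: the crux is completeness modulo `relations ⊔ closure TorsionTied` (definitional). [folklore] -/
theorem torsionSectorComplete_iff : TorsionSectorComplete ↔
    ∀ ⦃n m : ℕ⦄ (r : KZ.IntegralRep n) (r' : KZ.IntegralRep m), r.IsRational → r'.IsRational →
      r.value = r'.value → KZ.of r - KZ.of r' ∈ KZ.relations ⊔ AddSubgroup.closure TorsionTied :=
  Iff.rfl

/-- The tied ADDITION elements (member `true` data), as a subset of `FormalRep`. [cite: KontsevichZagier2001, §1.2] -/
def AdditionTied : Set KZ.FormalRep :=
  {d | ∃ (g₂ g₃ e₁ x₁ y₁ x₂ y₂ xQ yQ xS₁ xD₁ xS₂ xD₂ : ℝ) (f : ℝ → ℝ)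
      (rS₁ rD₁ rP₁ rS₂ rD₂ rP₂ : KZ.IntegralRep 2) (rL : KZ.IntegralRep 1),
    (∀ x, f x = 4 * x ^ 3 - g₂ * x - g₃) ∧ g₂ ^ 3 - 27 * g₃ ^ 2 ≠ 0 ∧ f e₁ = 0 ∧
    (∀ x, e₁ < x → 0 < f x) ∧ e₁ < x₂ ∧ x₂ < x₁ ∧ x₁ < xQ ∧
    y₁ ^ 2 = f x₁ ∧ y₂ ^ 2 = f x₂ ∧ yQ ^ 2 = f xQ ∧
    xS₁ = ((y₁ - yQ) / (x₁ - xQ)) ^ 2 / 4 - x₁ - xQ ∧ xD₁ = ((y₁ + yQ) / (x₁ - xQ)) ^ 2 / 4 - x₁ - xQ ∧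
    xS₂ = ((y₂ - yQ) / (x₂ - xQ)) ^ 2 / 4 - x₂ - xQ ∧ xD₂ = ((y₂ + yQ) / (x₂ - xQ)) ^ 2 / 4 - x₂ - xQ ∧
    rS₁.domain = {z | e₁ < z 1 ∧ z 1 < z 0 ∧ z 0 < xS₁} ∧
    Set.EqOn rS₁.integrand (fun z => z 1 / (Real.sqrt (f (z 1)) * Real.sqrt (f (z 0)))) rS₁.domain ∧
    rD₁.domain = {z | e₁ < z 1 ∧ z 1 < z 0 ∧ z 0 < xD₁} ∧
    Set.EqOn rD₁.integrand (fun z => z 1 / (Real.sqrt (f (z 1)) * Real.sqrt (f (z 0)))) rD₁.domain ∧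
    rP₁.domain = {z | e₁ < z 1 ∧ z 1 < z 0 ∧ z 0 < x₁} ∧
    Set.EqOn rP₁.integrand (fun z => z 1 / (Real.sqrt (f (z 1)) * Real.sqrt (f (z 0)))) rP₁.domain ∧
    rS₂.domain = {z | e₁ < z 1 ∧ z 1 < z 0 ∧ z 0 < xS₂} ∧
    Set.EqOn rS₂.integrand (fun z => z 1 / (Real.sqrt (f (z 1)) * Real.sqrt (f (z 0)))) rS₂.domain ∧
    rD₂.domain = {z | e₁ < z 1 ∧ z 1 < z 0 ∧ z 0 < xD₂} ∧
    Set.EqOn rD₂.integrand (fun z => z 1 / (Real.sqrt (f (z 1)) * Real.sqrt (f (z 0)))) rD₂.domain ∧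
    rP₂.domain = {z | e₁ < z 1 ∧ z 1 < z 0 ∧ z 0 < x₂} ∧
    Set.EqOn rP₂.integrand (fun z => z 1 / (Real.sqrt (f (z 1)) * Real.sqrt (f (z 0)))) rP₂.domain ∧
    rL.domain = {t | xQ - x₁ < t 0 ∧ t 0 < xQ - x₂} ∧ Set.EqOn rL.integrand (fun t => (t 0)⁻¹) rL.domain ∧
    rS₂.value + rD₂.value - 2 * rP₂.value - rS₁.value - rD₁.value + 2 * rP₁.value + rL.value = 0 ∧
    d = KZ.of rS₂ + KZ.of rD₂ - (2 : ℤ) • KZ.of rP₂ - KZ.of rS₁ - KZ.of rD₁ + (2 : ℤ) • KZ.of rP₁ + KZ.of rL}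

/-- RESIDUAL `AdditionSectorComplete`: Conjecture 1 for rational pairs MODULO the torsion sector ENLARGED by the
tied addition elements, `(relations ⊔ closure TorsionTied) ⊔ closure AdditionTied`. Weaker than the crux
(monotonicity of `⊔`); conjecture-grade. Kill path: a rational pair separated from the enlarged sector (genus-2 regulator, CM value, complex points). [cite: KontsevichZagier2001, §1.2] -/
def AdditionSectorComplete : Prop :=
  ∀ ⦃n m : ℕ⦄ (r : KZ.IntegralRep n) (r' : KZ.IntegralRep m), r.IsRational → r'.IsRational →
    r.value = r'.value →
    KZ.of r - KZ.of r' ∈ (KZ.relations ⊔ AddSubgroup.closure TorsionTied) ⊔ AddSubgroup.closure AdditionTied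


/-! ### Registered stubs -/

/-- **Stub 1 (XL — the NEW move, load-bearing): the addition shear.** Proof plan in the module docstring, (i)–(iii).
Why it might fail as typed: only through the multiplicities `(1,1,−2,−1,−1,2 ∣ +1)` of the primitive chain (the value
identity is verified numerically; the sign of `[rK]` is that of `log((x_Q−x₂)/(x_Q−x₁)) = value rK > 0`); the
semialgebraic bookkeeping of the sheared region (three `s`-ranges, boundary curves `y = x(R_s ∓ P_i)`) is uniform.
[cite: KontsevichZagier2001, §1.2] [cite: SilvermanATAEC1994, VI Cor. 3.3] -/
theorem stub_additionShear : AdditionShear := by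
  sorry

/-- **Stub 2 (M): the strip logarithm.** Proof plan: construct `rK` (domain `{a<s<b}×{0<t}` is `ℚ`-semialgebraic
since `a, b` are algebraic — read off `rL.domain` by `isAlgebraic_endpoints_of_isSemialgebraic_Ioo`; integrability of
`(s+t)⁻²` on the strip by Tonelli, inner value `1/s`); rule 2 `(s,t) ↦ (s, s/(s+t))` onto `{a<s<b}×{0<u<1}` with
integrand `1/s` (Jacobian `(s+t)²/s`); rule 3 in `u` (primitive `u/s`); then `[{a<s<b}, ds/s] = rL` by `EqOn`.
Why it might fail as typed: it cannot at the value level (`log(b/a)` on both sides, rational primitives only); size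
risk only. [cite: KontsevichZagier2001, §1.2] -/
theorem stub_stripLog : StripLog := by
  sorry

/-- **Stub 3 (residual, conjecture-grade).** [cite: KontsevichZagier2001, §1.2] -/
theorem stub_additionComplete : AdditionSectorComplete := by
  sorry

/-! ### The torsion member is the floor (no stub) -/

/-- **MEMBER `false` = the floor `stub_assembly` verbatim** (F3; witness file `Lines/NeronAddition_special.lean`).
[cite: KontsevichZagier2001, §1.2] -/
theorem neronAdditionMember_false : NeronAdditionMember false := by
  unfold NeronAdditionMember
  exact stub_assembly

/-! ### The addition member from the stubs -/

/-- **MEMBER `true` from stubs 1–2**: subtract the strip-logarithm chain from the shear chain. [cite: KontsevichZagier2001, §1.2] -/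
theorem neronAdditionMember_true_of (h₁ : AdditionShear) (h₂ : StripLog) : NeronAdditionMember true := by
  unfold NeronAdditionMember
  intro g₂ g₃ e₁ x₁ y₁ x₂ y₂ xQ yQ xS₁ xD₁ xS₂ xD₂ f hf hΔ he₁ hfpos hx₂ hx₂₁ hx₁Q hy₁ hy₂ hyQ hS₁ hD₁ hS₂ hD₂
    rS₁ rD₁ rP₁ rS₂ rD₂ rP₂ rL hS₁d hS₁i hD₁d hD₁i hP₁d hP₁i hS₂d hS₂i hD₂d hD₂i hP₂d hP₂i hLd hLi _hval
  obtain ⟨rK, hKd, hKi, hKL⟩ := h₂ (xQ - x₁) (xQ - x₂) (by linarith) (by linarith) rL hLd hLi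
  have hA := h₁ g₂ g₃ e₁ x₁ y₁ x₂ y₂ xQ yQ xS₁ xD₁ xS₂ xD₂ f hf hΔ he₁ hfpos hx₂ hx₂₁ hx₁Q hy₁ hy₂ hyQ hS₁ hD₁ hS₂ hD₂
    rS₁ rD₁ rP₁ rS₂ rD₂ rP₂ rK hS₁d hS₁i hD₁d hD₁i hP₁d hP₁i hS₂d hS₂i hD₂d hD₂i hP₂d hP₂i hKd hKi
  have h := sub_mem hA hKL
  convert h using 1
  abel

/-- **`NeronAddition_of`: the RUNG from stubs 1–2** (closed term; the torsion member is the floor).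
[cite: KontsevichZagier2001, §1.2] -/
theorem NeronAddition_of : AdditionShear → StripLog → NeronAddition := by
  intro h₁ h₂ addition
  cases addition
  · exact neronAdditionMember_false
  · exact neronAdditionMember_true_of h₁ h₂

/-- The rung itself from the registered stubs (closed term). [cite: KontsevichZagier2001, §1.2] -/
theorem neronAddition_holds : NeronAddition := NeronAddition_of stub_additionShear stub_stripLog

/-- Instantiation (F3 shape): each member from the rung. [folklore] -/
theorem member_of_rung (h : NeronAddition) (addition : Bool) : NeronAdditionMember addition := h addition

/-! ### The residual side; the crux by name -/

/-- The rung folds the tied addition elements into the moves: `closure AdditionTied ≤ KZ.relations`.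
[cite: KontsevichZagier2001, §1.2] -/
theorem closure_additionTied_le_relations (h : NeronAddition) :
    AddSubgroup.closure AdditionTied ≤ KZ.relations := by
  refine (AddSubgroup.closure_le _).mpr ?_
  rintro d ⟨g₂, g₃, e₁, x₁, y₁, x₂, y₂, xQ, yQ, xS₁, xD₁, xS₂, xD₂, f, rS₁, rD₁, rP₁, rS₂, rD₂, rP₂, rL, hf, hΔ, he₁,
    hfpos, hx₂, hx₂₁, hx₁Q, hy₁, hy₂, hyQ, hS₁, hD₁, hS₂, hD₂, hS₁d, hS₁i, hD₁d, hD₁i, hP₁d, hP₁i, hS₂d, hS₂i, hD₂d,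
    hD₂i, hP₂d, hP₂i, hLd, hLi, hval, rfl⟩
  have hT := h true
  unfold NeronAdditionMember at hT
  exact hT g₂ g₃ e₁ x₁ y₁ x₂ y₂ xQ yQ xS₁ xD₁ xS₂ xD₂ f hf hΔ he₁ hfpos hx₂ hx₂₁ hx₁Q hy₁ hy₂ hyQ hS₁ hD₁ hS₂ hD₂
    rS₁ rD₁ rP₁ rS₂ rD₂ rP₂ rL hS₁d hS₁i hD₁d hD₁i hP₁d hP₁i hS₂d hS₂i hD₂d hD₂i hP₂d hP₂i hLd hLi hval

/-- The residual is a consequence of the crux (monotonicity of `⊔`): stub 3 is WEAKER than the crux. [folklore] -/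
theorem additionSectorComplete_of_torsionSectorComplete (h : TorsionSectorComplete) : AdditionSectorComplete :=
  fun _ _ r r' hr hr' hv => AddSubgroup.mem_sup_left (h r r' hr hr' hv)

/-- The residual also follows from the summit directly. [folklore] -/
theorem additionSectorComplete_of_kontsevichZagierPeriods (h : _root_.KontsevichZagierPeriods) :
    AdditionSectorComplete :=
  additionSectorComplete_of_torsionSectorComplete
    (Summit.KontsevichZagierPeriods.TorsionLogs.TorsionSectorComplete.of_summit h)

/-- **`TorsionSectorComplete` from the three stubs** (closed term; `sorry` only through `stub_additionShear`,
`stub_stripLog`, `stub_additionComplete`): the rung folds `closure AdditionTied` into the moves, so the residual's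
enlarged sector is already `≤ relations ⊔ closure TorsionTied`. [cite: KontsevichZagier2001, §1.2] -/
theorem TorsionSectorComplete_of :
    Summit.KontsevichZagierPeriods.KontsevichZagierPeriods.Theses.TorsionLogs.TorsionSectorComplete := by
  suffices key : AdditionShear → StripLog → AdditionSectorComplete →
      Summit.KontsevichZagierPeriods.KontsevichZagierPeriods.Theses.TorsionLogs.TorsionSectorComplete from
    key stub_additionShear stub_stripLog stub_additionComplete
  intro h₁ h₂ h₃ n m r r' hr hr' hv
  have hR : NeronAddition := NeronAddition_of h₁ h₂
  have hle : (KZ.relations ⊔ AddSubgroup.closure TorsionTied) ⊔ AddSubgroup.closure AdditionTied ≤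
      KZ.relations ⊔ AddSubgroup.closure TorsionTied :=
    sup_le le_rfl ((closure_additionTied_le_relations hR).trans le_sup_left)
  exact hle (h₃ r r' hr hr' hv)

/-! ### On-path (F4): the summit implies the rung -/

/-- **ON-PATH (F4)** (verbatim in `Lines/NeronAddition_onpath.lean`): member `false` is a theorem (the floor);
for member `true`, the summit in kernel form applied to the tied element, whose evaluation vanishes by the value
hypothesis. Registered as an `aesop` apply rule so that the tribunal's cheap portfolio finds the landed lemma
(forward kernel: `on_path = true`, `uses_project = [neronAddition_of_kontsevichZagierPeriods]`). [cite: KontsevichZagier2001, §1.2] -/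
@[aesop safe apply]
theorem neronAddition_of_kontsevichZagierPeriods (h : _root_.KontsevichZagierPeriods) : NeronAddition := by
  intro addition
  cases addition
  · exact neronAdditionMember_false
  · unfold NeronAdditionMember
    intro g₂ g₃ e₁ x₁ y₁ x₂ y₂ xQ yQ xS₁ xD₁ xS₂ xD₂ f hf hΔ he₁ hfpos hx₂ hx₂₁ hx₁Q hy₁ hy₂ hyQ hS₁ hD₁ hS₂ hD₂
      rS₁ rD₁ rP₁ rS₂ rD₂ rP₂ rL hS₁d hS₁i hD₁d hD₁i hP₁d hP₁i hS₂d hS₂i hD₂d hD₂i hP₂d hP₂i hLd hLi hval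
    have hK : KZKernelConjecture := kzKernelConjecture_iff_isRational.mpr (KontsevichZagierPeriods_iff.mp h)
    refine hK _ ?_
    simp only [map_sub, map_add, map_zsmul, KZ.eval_of, zsmul_eq_mul, Int.cast_ofNat]
    linear_combination hval

/-- ON-PATH, member form. [cite: KontsevichZagier2001, §1.2] -/
@[aesop safe apply]
theorem neronAdditionMember_of_kontsevichZagierPeriods (h : _root_.KontsevichZagierPeriods) (addition : Bool) :
    NeronAdditionMember addition :=
  neronAddition_of_kontsevichZagierPeriods h addition

/-- F3 by name: the rung hands back the floor's statement. [folklore] -/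
theorem floor_of_neronAddition (h : NeronAddition) :
    Summit.KontsevichZagierPeriods.KontsevichZagierPeriods.Theses.TorsionLogs.NeronTorsionPrimitiveChain := by
  have h0 := h false
  unfold NeronAdditionMember at h0
  exact h0

/-- Informational square `summit ⇒ crux`, `summit ⇒ rung`, `summit ⇒ residual`. [folklore] -/
example (h : _root_.KontsevichZagierPeriods) : TorsionSectorComplete ∧ NeronAddition ∧ AdditionSectorComplete :=
  ⟨Summit.KontsevichZagierPeriods.TorsionLogs.TorsionSectorComplete.of_summit h,
   neronAddition_of_kontsevichZagierPeriods h, additionSectorComplete_of_kontsevichZagierPeriods h⟩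

end Summit.KontsevichZagierPeriods.KontsevichZagierPeriods.Cruxes.TorsionSectorComplete.NeronAddition
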